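import Mathlib
import HarnessLib

/-!
# `FemtoCurvatureSkewness` — binomial toolkit for stub `TreeRatioFloor` (crux stmt-QuantumFields-9365)

Elementary estimates on the binomial rows `C(2i, ·)` (the law of the lazy `±1` walk after `i` steps is
`s ↦ C(2i, s)/4^i`, centred at `s = i`) and `C(m, ·)`, used by the lazy-walk representation of the transverse
torus propagator in the proof of the tree-level ratio floor `TreeRatioFloor`:

* size of the centre: `(C(2i,i))² (2i+1) ≤ 16^i` and `16^i ≤ 4i (C(2i,i))²`;
* the product formula `C(2i,i+v) = C(2i,i) ∏_{r<v} (i-r)/(i+r+1)`, whence the Gaussian upper bound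
  `C(2i,s) ≤ C(2i,i) exp(-(s-i)²/(2i))` and the ratio floor `C(2i,i) ≤ e⁴ C(2i,i+n)` for `i ≥ n²`;
* the product of two central weights `p_i p_j ≥ 1/(2(i+j))`, `p_i = C(2i,i)/4^i`.

All statements are over `ℝ`; Mathlib only.  (Unimodality, the central block, the quarter tail and the binomial average
of the central weights are in the companion file `…TreeRatioFloorBlock`.)
-/

noncomputable section

namespace Summit.QuantumFields.YangMills.Theorems.FemtoCurvatureSkewness

open Finset
open scoped BigOperators

namespace TreeRatio

/-! ## The size of the central binomial coefficient -/

/-- Wallis upper bound: `C(2i,i)² (2i+1) ≤ 16^i`, i.e. `C(2i,i)/4^i ≤ 1/√(2i+1)`. -/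
theorem centralBinom_sq_mul_le (i : ℕ) : ((2 * i).choose i : ℝ) ^ 2 * (2 * i + 1) ≤ (16 : ℝ) ^ i := by
  -- adapted from Literature/Probability/LatticeModels/SlitPlaneKernel.lean (`centralBinom_div_sq_mul_le`)
  induction i with
  | zero => simp
  | succ n ih =>
    have hrec := Nat.succ_mul_centralBinom_succ n
    rw [Nat.centralBinom_eq_two_mul_choose, Nat.centralBinom_eq_two_mul_choose] at hrec
    have hrec' : ((n + 1 : ℕ) : ℝ) * ((2 * (n + 1)).choose (n + 1) : ℝ) =
        2 * (2 * (n : ℝ) + 1) * ((2 * n).choose n : ℝ) := by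
      exact_mod_cast hrec
    push_cast at hrec' ⊢
    have hc : ((2 * (n + 1)).choose (n + 1) : ℝ) = 2 * (2 * n + 1) * (2 * n).choose n / (n + 1) := by
      field_simp; linarith
    rw [hc]
    have hpos : (0 : ℝ) < n + 1 := by positivity
    have hC : 0 ≤ ((2 * n).choose n : ℝ) := by positivity
    have key : (2 * (2 * (n : ℝ) + 1) * (2 * n).choose n / (n + 1)) ^ 2 * (2 * (n + 1) + 1) =
        ((2 * n).choose n : ℝ) ^ 2 * (2 * n + 1) * (4 * (2 * n + 1) * (2 * n + 3) / ((n + 1) ^ 2)) := by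
      field_simp; ring
    rw [key, pow_succ]
    have hpos2 : (0 : ℝ) < ((n : ℝ) + 1) ^ 2 := by positivity
    have h2 : 4 * (2 * (n : ℝ) + 1) * (2 * n + 3) / ((n + 1) ^ 2) ≤ 16 := by
      rw [div_le_iff₀ hpos2]; nlinarith
    have hc0 : (0 : ℝ) ≤ 4 * (2 * (n : ℝ) + 1) * (2 * n + 3) / ((n + 1) ^ 2) := by positivity
    have h16 : (0 : ℝ) ≤ (16 : ℝ) ^ n := by positivity
    exact mul_le_mul ih h2 hc0 h16

/-- Wallis lower bound: `16^i ≤ 4i C(2i,i)²` for `i ≥ 1`, i.e. `C(2i,i)/4^i ≥ 1/(2√i)`. -/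
theorem sixteen_pow_le_centralBinom_sq {i : ℕ} (hi : 1 ≤ i) : (16 : ℝ) ^ i ≤ 4 * i * ((2 * i).choose i : ℝ) ^ 2 := by
  -- adapted from Literature/Probability/RandomPlanarGeometry/PlaneNonIntersectionLowerBound.lean
  have hnat : 16 ^ i ≤ 4 * i * (2 * i).choose i ^ 2 := by
    induction i, hi using Nat.le_induction with
    | base => decide
    | succ k _ ih =>
        have hrec := Nat.succ_mul_centralBinom_succ k
        rw [Nat.centralBinom_eq_two_mul_choose, Nat.centralBinom_eq_two_mul_choose] at hrec
        refine Nat.le_of_mul_le_mul_left ?_ (Nat.succ_pos k)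
        have h1 : (k + 1) * (4 * (k + 1) * (2 * (k + 1)).choose (k + 1) ^ 2) =
            4 * ((k + 1) * (2 * (k + 1)).choose (k + 1)) ^ 2 := by ring
        rw [h1, hrec]
        calc (k + 1) * 16 ^ (k + 1) = 16 * (k + 1) * 16 ^ k := by ring
          _ ≤ 16 * (k + 1) * (4 * k * (2 * k).choose k ^ 2) := Nat.mul_le_mul_left _ ih
          _ = 16 * (4 * (k * (k + 1))) * (2 * k).choose k ^ 2 := by ring
          _ ≤ 16 * (2 * k + 1) ^ 2 * (2 * k).choose k ^ 2 := by
              refine Nat.mul_le_mul_right _ (Nat.mul_le_mul_left _ ?_)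
              nlinarith
          _ = 4 * (2 * (2 * k + 1) * (2 * k).choose k) ^ 2 := by ring
  exact_mod_cast hnat

/-- The central weight `p_i = C(2i,i)/4^i` satisfies `p_i² (2i+1) ≤ 1`. -/
theorem centralWeight_sq_mul_le (i : ℕ) : (((2 * i).choose i : ℝ) / 4 ^ i) ^ 2 * (2 * i + 1) ≤ 1 := by
  have h := centralBinom_sq_mul_le i
  have h16 : (16 : ℝ) ^ i = (4 ^ i) ^ 2 := by rw [← pow_mul, mul_comm, pow_mul]; norm_num
  have hpos : (0 : ℝ) < (4 : ℝ) ^ i := by positivity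
  rw [div_pow, div_mul_eq_mul_div, div_le_one (by positivity), ← h16]
  exact h

/-- The central weights satisfy `1 ≤ 4 i p_i²` for `i ≥ 1`. -/
theorem one_le_centralWeight_sq {i : ℕ} (hi : 1 ≤ i) : 1 ≤ 4 * i * (((2 * i).choose i : ℝ) / 4 ^ i) ^ 2 := by
  have h := sixteen_pow_le_centralBinom_sq hi
  have h16 : (16 : ℝ) ^ i = (4 ^ i) ^ 2 := by rw [← pow_mul, mul_comm, pow_mul]; norm_num
  have hpos : (0 : ℝ) < ((4 : ℝ) ^ i) ^ 2 := by positivity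
  rw [div_pow, ← mul_div_assoc, one_le_div hpos, ← h16]
  exact h

/-- Product of two central weights: `p_i p_j ≥ 1/(2(i+j))` for `i, j ≥ 1` (from `1 ≤ 4ip_i²` and AM–GM). -/
theorem centralWeight_mul_ge {i j : ℕ} (hi : 1 ≤ i) (hj : 1 ≤ j) :
    1 / (2 * ((i : ℝ) + j)) ≤ ((2 * i).choose i : ℝ) / 4 ^ i * (((2 * j).choose j : ℝ) / 4 ^ j) := by
  set a := ((2 * i).choose i : ℝ) / 4 ^ i
  set b := ((2 * j).choose j : ℝ) / 4 ^ j
  have ha : 0 ≤ a := by positivity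
  have hb : 0 ≤ b := by positivity
  have h1 := one_le_centralWeight_sq hi
  have h2 := one_le_centralWeight_sq hj
  have hij : (0 : ℝ) < 2 * ((i : ℝ) + j) := by positivity
  -- `(ab)² · 16 i j ≥ 1` and `16 i j ≤ 4 (i+j)²`
  have hsq : (1 / (2 * ((i : ℝ) + j))) ^ 2 ≤ (a * b) ^ 2 := by
    have hprod : 1 ≤ (4 * i * a ^ 2) * (4 * j * b ^ 2) := one_le_mul_of_one_le_of_one_le h1 h2
    have hamgm : 16 * (i : ℝ) * j ≤ (2 * ((i : ℝ) + j)) ^ 2 := by nlinarith [sq_nonneg ((i : ℝ) - j)]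
    rw [div_pow, one_pow, div_le_iff₀ (by positivity)]
    nlinarith [sq_nonneg (a * b), mul_nonneg ha hb]
  exact (pow_le_pow_iff_left₀ (by positivity) (mul_nonneg ha hb) two_ne_zero).mp hsq

/-! ## The product formula and its consequences -/

/-- Product formula: `C(2i, i+v) = C(2i, i) · ∏_{r<v} (i-r)/(i+r+1)` for `v ≤ i`. -/
theorem choose_center_add_eq (i : ℕ) : ∀ v : ℕ, v ≤ i →
    ((2 * i).choose (i + v) : ℝ) = (2 * i).choose i * ∏ r ∈ range v, (((i : ℝ) - r) / ((i : ℝ) + r + 1)) := by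
  intro v
  induction v with
  | zero => intro _; simp
  | succ v ih =>
    intro hv
    have hv' : v ≤ i := Nat.le_of_succ_le hv
    have hrec := Nat.choose_succ_right_eq (2 * i) (i + v)
    -- `C(2i, i+v+1) (i+v+1) = C(2i, i+v) (i - v)`
    have hsub : 2 * i - (i + v) = i - v := by omega
    rw [hsub] at hrec
    have hrec' : ((2 * i).choose (i + v + 1) : ℝ) * ((i : ℝ) + v + 1) = (2 * i).choose (i + v) * ((i : ℝ) - v) := by
      have := congrArg (fun n : ℕ => (n : ℝ)) hrec
      push_cast [Nat.cast_sub hv'] at this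
      linarith
    have hpos : (0 : ℝ) < (i : ℝ) + v + 1 := by positivity
    rw [show i + (v + 1) = i + v + 1 by ring, prod_range_succ, ← mul_assoc, ← ih hv', mul_div_assoc',
      eq_div_iff hpos.ne']
    exact hrec'

/-- Gaussian upper bound on the right half: `C(2i, i+v) ≤ C(2i,i) exp(-v²/(2i))` for `v ≤ i`. -/
theorem choose_center_add_le_exp (i v : ℕ) (hv : v ≤ i) :
    ((2 * i).choose (i + v) : ℝ) ≤ (2 * i).choose i * Real.exp (-((v : ℝ) ^ 2) / (2 * i)) := by
  rcases Nat.eq_zero_or_pos i with hi | hi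
  · subst hi
    have : v = 0 := by omega
    subst this
    simp
  have hipos : (0 : ℝ) < i := by exact_mod_cast hi
  rw [choose_center_add_eq i v hv]
  refine mul_le_mul_of_nonneg_left ?_ (by positivity)
  -- each factor `(i-r)/(i+r+1) = 1 - (2r+1)/(i+r+1) ≤ exp(-(2r+1)/(i+r+1)) ≤ exp(-(2r+1)/(2i))`
  have hfac : ∀ r ∈ range v, ((i : ℝ) - r) / ((i : ℝ) + r + 1) ≤ Real.exp (-(2 * (r : ℝ) + 1) / (2 * i)) := by
    intro r hr
    have hr' : r < v := mem_range.mp hr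
    have hden : (0 : ℝ) < (i : ℝ) + r + 1 := by positivity
    have hri : (r : ℝ) + 1 ≤ i := by exact_mod_cast (show r + 1 ≤ i by omega)
    calc ((i : ℝ) - r) / ((i : ℝ) + r + 1) = -(2 * (r : ℝ) + 1) / ((i : ℝ) + r + 1) + 1 := by
          field_simp; ring
      _ ≤ Real.exp (-(2 * (r : ℝ) + 1) / ((i : ℝ) + r + 1)) := Real.add_one_le_exp _
      _ ≤ Real.exp (-(2 * (r : ℝ) + 1) / (2 * i)) := by
          refine Real.exp_le_exp.mpr ?_
          rw [neg_div, neg_div, neg_le_neg_iff]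
          exact div_le_div_of_nonneg_left (by positivity) hden (by linarith)
  have hnonneg : ∀ r ∈ range v, 0 ≤ ((i : ℝ) - r) / ((i : ℝ) + r + 1) := by
    intro r hr
    have hr' : r < v := mem_range.mp hr
    have hri : (r : ℝ) ≤ i := by exact_mod_cast (show r ≤ i by omega)
    exact div_nonneg (by linarith) (by positivity)
  calc ∏ r ∈ range v, ((i : ℝ) - r) / ((i : ℝ) + r + 1)
      ≤ ∏ r ∈ range v, Real.exp (-(2 * (r : ℝ) + 1) / (2 * i)) := prod_le_prod hnonneg hfac
    _ = Real.exp (∑ r ∈ range v, -(2 * (r : ℝ) + 1) / (2 * i)) := (Real.exp_sum _ _).symm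
    _ = Real.exp (-((v : ℝ) ^ 2) / (2 * i)) := by
        -- the odd numbers below `2v` sum to `v²`
        have hodd : ∀ w : ℕ, ∑ r ∈ range w, (2 * (r : ℝ) + 1) = (w : ℝ) ^ 2 := by
          intro w
          induction w with
          | zero => simp
          | succ w ih => rw [sum_range_succ, ih]; push_cast; ring
        congr 1
        rw [← hodd v, ← sum_div, ← sum_neg_distrib]

/-- Gaussian upper bound on the whole row: `C(2i, s) ≤ C(2i,i) exp(-(s-i)²/(2i))` for `s ≤ 2i`. -/
theorem choose_le_center_mul_exp (i s : ℕ) (hs : s ≤ 2 * i) :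
    ((2 * i).choose s : ℝ) ≤ (2 * i).choose i * Real.exp (-(((s : ℝ) - i) ^ 2) / (2 * i)) := by
  rcases le_total i s with h | h
  · -- `s = i + v`
    obtain ⟨v, rfl⟩ := Nat.exists_eq_add_of_le h
    have hv : v ≤ i := by omega
    have e : ((i + v : ℕ) : ℝ) - i = v := by push_cast; ring
    rw [e]
    exact choose_center_add_le_exp i v hv
  · -- `s = i - v`, use the symmetry `C(2i, s) = C(2i, 2i - s)`
    obtain ⟨v, hv⟩ : ∃ v, s + v = i := ⟨i - s, by omega⟩
    have hsymm : (2 * i).choose s = (2 * i).choose (i + v) := by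
      rw [← Nat.choose_symm hs]; congr 1; omega
    have e : ((s : ℝ) - i) ^ 2 = (v : ℝ) ^ 2 := by
      have : (i : ℝ) = s + v := by exact_mod_cast hv.symm
      rw [this]; ring
    rw [hsymm, e]
    exact choose_center_add_le_exp i v (by omega)

/-- Ratio floor at distance `n ≤ √i` from the centre: `C(2i, i) ≤ e⁴ C(2i, i+n)` for `1 ≤ n`, `n² ≤ i`. -/
theorem choose_center_le_exp_four_mul {i n : ℕ} (hn : 1 ≤ n) (hi : n ^ 2 ≤ i) :
    ((2 * i).choose i : ℝ) ≤ Real.exp 4 * (2 * i).choose (i + n) := by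
  have hni : n ≤ i := le_trans (by nlinarith) hi
  have hipos : (0 : ℝ) < i := by exact_mod_cast (lt_of_lt_of_le (by nlinarith) hi)
  rw [choose_center_add_eq i n hni]
  -- each factor is at least `1 - x`, `x = (2n-1)/(i+n) ∈ [0, 1/2]`
  set x : ℝ := (2 * (n : ℝ) - 1) / ((i : ℝ) + n) with hx
  have hden : (0 : ℝ) < (i : ℝ) + n := by positivity
  have hn1 : (1 : ℝ) ≤ n := by exact_mod_cast hn
  have hin : (n : ℝ) ^ 2 ≤ i := by exact_mod_cast hi
  have hx0 : 0 ≤ x := div_nonneg (by linarith) hden.le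
  have hx1 : x ≤ 1 / 2 := by
    rw [hx, div_le_iff₀ hden]
    rcases (show n = 1 ∨ 2 ≤ n by omega) with h1 | h2
    · subst h1
      have hi1 : (1 : ℝ) ≤ i := by exact_mod_cast hi
      norm_num
      linarith
    · have hn2 : (2 : ℝ) ≤ n := by exact_mod_cast h2
      nlinarith [mul_nonneg (show (0 : ℝ) ≤ n - 1 by linarith) (show (0 : ℝ) ≤ n - 2 by linarith)]
  have hnx : 2 * (n * x) ≤ 4 := by
    rw [hx, mul_div_assoc', mul_div_assoc', div_le_iff₀ hden]
    nlinarith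
  have hfac : ∀ r ∈ range n, 1 - x ≤ ((i : ℝ) - r) / ((i : ℝ) + r + 1) := by
    intro r hr
    have hr' : r < n := mem_range.mp hr
    have hr1 : (r : ℝ) + 1 ≤ n := by exact_mod_cast hr'
    have hden' : (0 : ℝ) < (i : ℝ) + r + 1 := by positivity
    have hle : (2 * (r : ℝ) + 1) / ((i : ℝ) + r + 1) ≤ x := by
      rw [hx, div_le_div_iff₀ hden' hden]
      nlinarith [mul_nonneg (show (0 : ℝ) ≤ 2 * i + 1 by positivity) (show (0 : ℝ) ≤ n - r - 1 by linarith)]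
    calc 1 - x ≤ 1 - (2 * (r : ℝ) + 1) / ((i : ℝ) + r + 1) := by linarith
      _ = ((i : ℝ) - r) / ((i : ℝ) + r + 1) := by field_simp; ring
  have hprod : (1 - x) ^ n ≤ ∏ r ∈ range n, ((i : ℝ) - r) / ((i : ℝ) + r + 1) := by
    calc (1 - x) ^ n = ∏ _r ∈ range n, (1 - x) := by simp
      _ ≤ ∏ r ∈ range n, ((i : ℝ) - r) / ((i : ℝ) + r + 1) :=
          prod_le_prod (fun _ _ => by linarith) hfac
  -- `exp(-2x) ≤ 1 - x` on `[0, 1/2]` (from `log y ≥ 1 - 1/y`)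
  have hexp1 : Real.exp (-2 * x) ≤ 1 - x := by
    have hpos : 0 < 1 - x := by linarith
    have hlog : 1 - (1 - x)⁻¹ ≤ Real.log (1 - x) := Real.one_sub_inv_le_log_of_pos hpos
    have hinv : (1 - x)⁻¹ ≤ 1 + 2 * x := by
      rw [inv_le_iff_one_le_mul₀ hpos]
      nlinarith
    calc Real.exp (-2 * x) ≤ Real.exp (Real.log (1 - x)) := Real.exp_le_exp.mpr (by linarith)
      _ = 1 - x := Real.exp_log hpos
  have hexp : Real.exp (-4) ≤ (1 - x) ^ n := by
    calc Real.exp (-4) ≤ Real.exp (n * (-2 * x)) := Real.exp_le_exp.mpr (by nlinarith)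
      _ = Real.exp (-2 * x) ^ n := by rw [Real.exp_nat_mul]
      _ ≤ (1 - x) ^ n := pow_le_pow_left₀ (Real.exp_pos _).le hexp1 n
  have hC : (0 : ℝ) ≤ (2 * i).choose i := by positivity
  calc ((2 * i).choose i : ℝ) = Real.exp 4 * ((2 * i).choose i * Real.exp (-4)) := by
        rw [mul_comm (Real.exp 4), mul_assoc, ← Real.exp_add]; norm_num
    _ ≤ Real.exp 4 * ((2 * i).choose i * ∏ r ∈ range n, ((i : ℝ) - r) / ((i : ℝ) + r + 1)) :=
        mul_le_mul_of_nonneg_left (mul_le_mul_of_nonneg_left (hexp.trans hprod) hC) (Real.exp_pos _).le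

end TreeRatio

/-- **Ratio floor of the central binomial row** (registered sub-goal `TreeRatioCentralRatio`): `C(2i,i) ≤ e⁴ C(2i,i+n)` for `1 ≤ n`, `n² ≤ i`. -/
theorem TreeRatioCentralRatio : ∀ (i n : ℕ), 1 ≤ n → n ^ 2 ≤ i → ((2 * i).choose i : ℝ) ≤ Real.exp 4 * ((2 * i).choose (i + n) : ℝ) :=
  fun _ _ hn hi => TreeRatio.choose_center_le_exp_four_mul hn hi

end Summit.QuantumFields.YangMills.Theorems.FemtoCurvatureSkewness

end
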